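import Mathlib
import Literature.LinearAlgebra.Matrix.FaddeevLeVerrier

/-!
# The LeVerrier tensor train: `det` as a width-`(n² + 1)` layered matrix product

Helper file for item `DetReprLift` (stmt-ValiantsHypothesis-5924) of route `LiftNullstellensatz`
(`Summits/ValiantsHypothesis/ValiantsHypothesis/Theses/LiftNullstellensatz.lean`).

For a square matrix `M` over a commutative ring `R` (index type `n`, `N = #n`) write the
characteristic polynomial as `χ_M = Σ_k c_k X^k` and let `N_l = Σ_{l<k≤N} c_k M^{k-1-l}` be the
Faddeev–LeVerrier matrices (`Literature.LinearAlgebra.Matrix.flMat`, file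
`Literature/LinearAlgebra/Matrix/FaddeevLeVerrier.lean`, where the recursion
`N_{l-1} = M N_l + c_l 1`, `(N - l) c_l = -tr (M N_l)`, `c_0 = det (−M)` is PROVED).  Reading the
recursion degree by degree gives a layered automaton ("homogeneous algebraic branching program")
of width `#n² + 1` computing `det (−M)` — the classical small-width determinant program
(LeVerrier 1840 / Csanky 1976; cf. Mahajan–Vinay 1997 for the division-free clow version):

* states `Option (n × n)`: `none` = "at a coefficient `c_{N-t}`", `some (a, b)` = "inside a trace
  block started at row `a`, now at column `b`";
* `lvLayer κ M` — the one-layer transition matrix with closing weight `κ` (entries: `κ · tr M`,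
  `M a b`, `[a = a'] · M b b'`, `κ · M b a`), LINEAR in `M` (`lvLayer_add`, `lvLayer_smul`,
  `lvLayer_sum`, `lvLayer_map`);
* `lvVec κ M t` — the covector after `t` layers, started at `none`, layer `t` closed with weight
  `κ t`;
* `lvVec_invariant` — if `(t + 1) · κ t = -1` for `t < N` then after `t ≤ N` layers the covector is
  `(c_{N-t}, (M · N_{N-t})_{a b})`; hence **`lvVec_card_dotProduct`**: the `none`-coordinate after
  `N` layers is `c_0 = det (−M)`.

[folklore]
-/

namespace Summit.ValiantsHypothesis.ValiantsHypothesis.Theorems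

-- the single-problem summit's namespace `Summit.ValiantsHypothesis.ValiantsHypothesis` repeats
set_option linter.dupNamespace false

namespace DetReprLift

open Matrix Literature.LinearAlgebra.Matrix

variable {R : Type*} [CommRing R] {n : Type*} [Fintype n] [DecidableEq n]

/-- **The LeVerrier layer** with closing weight `κ`: the transition matrix on the states
`Option (n × n)` reading one (matrix-valued) letter `M` — from `none` one opens a trace block at any
row `a` and moves to column `b` with weight `M a b`, or opens and closes a block of length one with
weight `κ · tr M`; from `some (a, b)` one moves to `some (a, b')` with weight `M b b'` or closes
the block (back to row `a`) with weight `κ · M b a`. [folklore] -/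
def lvLayer (κ : R) (M : Matrix n n R) : Matrix (Option (n × n)) (Option (n × n)) R :=
  Matrix.of fun p q =>
    match p, q with
    | none, none => κ * M.trace
    | none, some q => M q.1 q.2
    | some p, some q => if p.1 = q.1 then M p.2 q.2 else 0
    | some p, none => κ * M p.2 p.1

/-- Entry `none → none` of the LeVerrier layer. [folklore] -/
@[simp] theorem lvLayer_none_none (κ : R) (M : Matrix n n R) :
    lvLayer κ M none none = κ * M.trace := rfl

/-- Entry `none → some` of the LeVerrier layer. [folklore] -/
@[simp] theorem lvLayer_none_some (κ : R) (M : Matrix n n R) (q : n × n) :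
    lvLayer κ M none (some q) = M q.1 q.2 := rfl

/-- Entry `some → some` of the LeVerrier layer. [folklore] -/
@[simp] theorem lvLayer_some_some (κ : R) (M : Matrix n n R) (p q : n × n) :
    lvLayer κ M (some p) (some q) = if p.1 = q.1 then M p.2 q.2 else 0 := rfl

/-- Entry `some → none` of the LeVerrier layer. [folklore] -/
@[simp] theorem lvLayer_some_none (κ : R) (M : Matrix n n R) (p : n × n) :
    lvLayer κ M (some p) none = κ * M p.2 p.1 := rfl

/-- The LeVerrier layer is additive in the letter. [folklore] -/
theorem lvLayer_add (κ : R) (M M' : Matrix n n R) :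
    lvLayer κ (M + M') = lvLayer κ M + lvLayer κ M' := by
  ext p q
  rcases p with _ | p <;> rcases q with _ | q
  · simp [Matrix.trace_add, mul_add]
  · simp
  · simp [mul_add]
  · simp only [lvLayer_some_some, Matrix.add_apply]
    split_ifs <;> simp

/-- The LeVerrier layer of the zero letter vanishes. [folklore] -/
theorem lvLayer_zero (κ : R) : lvLayer κ (0 : Matrix n n R) = 0 := by
  ext p q
  rcases p with _ | p <;> rcases q with _ | q <;> simp

/-- The LeVerrier layer is homogeneous in the letter. [folklore] -/
theorem lvLayer_smul (κ c : R) (M : Matrix n n R) :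
    lvLayer κ (c • M) = c • lvLayer κ M := by
  ext p q
  rcases p with _ | p <;> rcases q with _ | q
  · simp [Matrix.trace_smul, mul_left_comm κ c]
  · simp
  · simp [mul_left_comm κ c]
  · simp only [lvLayer_some_some, Matrix.smul_apply, smul_eq_mul]
    split_ifs <;> simp

/-- The LeVerrier layer of a finite sum of letters. [folklore] -/
theorem lvLayer_sum {ι : Type*} (κ : R) (s : Finset ι) (M : ι → Matrix n n R) :
    lvLayer κ (∑ i ∈ s, M i) = ∑ i ∈ s, lvLayer κ (M i) := by
  classical
  induction s using Finset.induction_on with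
  | empty => simp [lvLayer_zero]
  | insert i s hi ih => rw [Finset.sum_insert hi, Finset.sum_insert hi, lvLayer_add, ih]

/-- The LeVerrier layer commutes with a change of scalars. [folklore] -/
theorem lvLayer_map {R' : Type*} [CommRing R'] (f : R →+* R') (κ : R) (M : Matrix n n R) :
    (lvLayer κ M).map f = lvLayer (f κ) (M.map f) := by
  ext p q
  rcases p with _ | p <;> rcases q with _ | q
  · simp [Matrix.trace, Matrix.diag, map_sum]
  · simp
  · simp
  · simp only [Matrix.map_apply, lvLayer_some_some]
    split_ifs <;> simp

/-- **The LeVerrier covector after `t` layers**: start at `none`, and close layer `t` with the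
weight `κ t`. [folklore] -/
def lvVec (κ : ℕ → R) (M : Matrix n n R) : ℕ → Option (n × n) → R
  | 0 => Pi.single none 1
  | t + 1 => lvVec κ M t ᵥ* lvLayer (κ t) M

/-- `lvVec` at layer `0`. [folklore] -/
@[simp] theorem lvVec_zero (κ : ℕ → R) (M : Matrix n n R) : lvVec κ M 0 = Pi.single none 1 := rfl

/-- `lvVec` at a successor layer. [folklore] -/
theorem lvVec_succ (κ : ℕ → R) (M : Matrix n n R) (t : ℕ) :
    lvVec κ M (t + 1) = lvVec κ M t ᵥ* lvLayer (κ t) M := rfl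

/-- One LeVerrier step, coordinatewise: the `vecMul` over `Option (n × n)` split into the `none`
term and the double sum over `some (a, b)`. [folklore] -/
theorem vecMul_lvLayer_apply (v : Option (n × n) → R) (κ : R) (M : Matrix n n R)
    (q : Option (n × n)) :
    (v ᵥ* lvLayer κ M) q =
      v none * lvLayer κ M none q + ∑ a, ∑ b, v (some (a, b)) * lvLayer κ M (some (a, b)) q := by
  simp only [Matrix.vecMul, dotProduct]
  rw [Fintype.sum_option, Fintype.sum_prod_type]

/-- The Faddeev–LeVerrier matrices are polynomials in `M`, so they commute with `M`. [folklore] -/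
theorem commute_flMat (M : Matrix n n R) (l : ℕ) : Commute M (flMat M l) := by
  unfold flMat
  refine Commute.sum_right _ _ _ fun k _ => ?_
  split_ifs
  · exact ((Commute.refl M).pow_right _).smul_right _
  · exact Commute.zero_right M

/-- **The LeVerrier invariant.** If `(t + 1) · κ t = -1` for all `t < N = #n`, then after `t ≤ N`
layers the covector has `none`-coordinate `c_{N-t}` (coefficient of the characteristic polynomial)
and `some (a, b)`-coordinate `(M · N_{N-t}) a b` (`N_l` the Faddeev–LeVerrier matrices).
[folklore] -/
theorem lvVec_invariant (κ : ℕ → R) (M : Matrix n n R)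
    (hκ : ∀ t < Fintype.card n, ((t : R) + 1) * κ t = -1) (t : ℕ) (ht : t ≤ Fintype.card n) :
    lvVec κ M t none = M.charpoly.coeff (Fintype.card n - t) ∧
      ∀ a b, lvVec κ M t (some (a, b)) = (M * flMat M (Fintype.card n - t)) a b := by
  rcases subsingleton_or_nontrivial R with hR | hR
  · exact ⟨Subsingleton.elim _ _, fun _ _ => Subsingleton.elim _ _⟩
  induction t with
  | zero =>
    refine ⟨?_, fun a b => ?_⟩
    · rw [lvVec_zero, Pi.single_eq_same, Nat.sub_zero]
      have h := M.charpoly_monic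
      rw [Polynomial.Monic, Polynomial.leadingCoeff, charpoly_natDegree_eq_dim] at h
      exact h.symm
    · rw [lvVec_zero, Pi.single_eq_of_ne (Option.some_ne_none _), Nat.sub_zero,
        flMat_of_card_le M le_rfl, Matrix.mul_zero, Matrix.zero_apply]
  | succ t ih =>
    have ht' : t < Fintype.card n := ht
    obtain ⟨ih0, ih1⟩ := ih ht'.le
    -- the Faddeev–LeVerrier recursion at `l = N - (t + 1)`, with `N_{N-t}` commuted past `M`
    have hrec : M * flMat M (Fintype.card n - (t + 1)) =
        M * flMat M (Fintype.card n - t) * M + M.charpoly.coeff (Fintype.card n - t) • M := by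
      have h := flMat_eq_mul_add M (Fintype.card n - (t + 1))
      rw [show Fintype.card n - (t + 1) + 1 = Fintype.card n - t by omega] at h
      rw [h, Matrix.mul_add, Matrix.mul_smul, Matrix.mul_one, Matrix.mul_assoc,
        ← (commute_flMat M (Fintype.card n - t)).eq]
    set P := M * flMat M (Fintype.card n - t) with hP
    set c := M.charpoly.coeff (Fintype.card n - t) with hc
    refine ⟨?_, fun a' b' => ?_⟩
    · -- the `none` coordinate: `κ_t · tr (M N_{N-t-1}) = c_{N-t-1}`
      rw [lvVec_succ, vecMul_lvLayer_apply, ih0]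
      simp_rw [ih1]
      simp only [lvLayer_none_none, lvLayer_some_none]
      have hstep := sub_mul_charpoly_coeff M (l := Fintype.card n - (t + 1)) (by omega)
      rw [show Fintype.card n - (Fintype.card n - (t + 1)) = t + 1 by omega, Nat.cast_succ, hrec,
        Matrix.trace_add, Matrix.trace_smul, smul_eq_mul] at hstep
      have htr : (P * M).trace = ∑ a, ∑ b, P a b * M b a := by
        simp only [Matrix.trace, Matrix.diag, Matrix.mul_apply]
      rw [htr] at hstep
      have hk := hκ t ht'
      calc c * (κ t * M.trace) + ∑ a, ∑ b, P a b * (κ t * M b a)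
          = -κ t * (-(∑ a, ∑ b, P a b * M b a + c * M.trace)) := by
            rw [neg_mul_neg, mul_add, add_comm, Finset.mul_sum]
            congr 1
            · refine Finset.sum_congr rfl fun a _ => ?_
              rw [Finset.mul_sum]
              refine Finset.sum_congr rfl fun b _ => ?_
              ring
            · ring
        _ = -κ t * (((t : R) + 1) * M.charpoly.coeff (Fintype.card n - (t + 1))) := by rw [hstep]
        _ = M.charpoly.coeff (Fintype.card n - (t + 1)) := by
            rw [← mul_assoc, mul_comm (-κ t), mul_neg, hk, neg_neg, one_mul]
    · -- the `some (a', b')` coordinate: `c M + (M N) M = M N'`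
      rw [lvVec_succ, vecMul_lvLayer_apply, ih0, hrec, Matrix.add_apply, Matrix.smul_apply,
        smul_eq_mul, Matrix.mul_apply, add_comm]
      simp_rw [ih1]
      simp only [lvLayer_none_some, lvLayer_some_some, mul_ite, mul_zero]
      congr 1
      rw [Finset.sum_comm]
      refine Finset.sum_congr rfl fun b _ => ?_
      rw [Finset.sum_ite_eq', if_pos (Finset.mem_univ _)]

/-- **`det` by the LeVerrier tensor train**: if `(t + 1) · κ t = -1` for `t < #n` then the
`none`-coordinate of the LeVerrier covector after `#n` layers is `c_0 = det (−M)`. [folklore] -/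
theorem lvVec_card_dotProduct (κ : ℕ → R) (M : Matrix n n R)
    (hκ : ∀ t < Fintype.card n, ((t : R) + 1) * κ t = -1) :
    lvVec κ M (Fintype.card n) ⬝ᵥ Pi.single none 1 = (-M).det := by
  rw [dotProduct_single, mul_one, (lvVec_invariant κ M hκ _ le_rfl).1, Nat.sub_self,
    charpoly_coeff_zero_eq_det_neg]

end DetReprLift

end Summit.ValiantsHypothesis.ValiantsHypothesis.Theorems
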